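import Literature.Topology.FourManifolds.CoreParams
import Literature.Topology.FourManifolds.MonotoneInverse
import HarnessLib

/-!
# The planar track of the deep closing arc: turn profiles and the tip clock

Topic `Literature/Topology/FourManifolds` (trunk T-4MAN). Fact seat
`provefact-Literature.Topology.FourManifolds.Knot.IsConnectedSum.isIsotopic` (Schubert's theorem),
geometric heart for rail knots, deep-chord design. The closing arc of a datum `b` at the neck
scale `κ` on the southern side is the band image of a planar track (relative to the centre of the
band, in blow-up units `κ`): along the lower neck line `x₁ = -1` while the blown-up parameter
`αLo` runs up to `7/2`, then a smooth right-angle **turn** onto the vertical line `x₀ = 4`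
(reached at `αLo = 4`, the second coordinate starting to climb at `αLo = 15/4`, so the track is
regular), then the vertical **tip** `x₀ = 4` while the loop parameter crosses from the lower core
to the upper core, and the mirror image back along the upper neck line. This file provides:

* the turn profiles `turnX a = a + (4 - a) S a`, `turnV a = -1 + (a - 15/4) T a / 2`
  (`S = smoothStep (7/2) 4`, `T = smoothStep (15/4) (9/2)`), `lowerTurn a = (turnX a, turnV a)`,
  `upperTurn a = (turnX a, -turnV a)`: values off the transition windows, bounds
  (`turnX ∈ [a ⊓ 4, 4]`, `turnV ∈ [-1, -3/8]` on `[0, 5]`), monotonicity, regularity and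
  injectivity on `[-7, 5]`;
* the **tip clock** `b.tipClock hκ h7 h7'` (`exists_tipClock`): a `C^∞` function equal to
  `-1 + (αLo - 15/4)/2` left of `parLo 5` and to `1 - (αHi - 15/4)/2` right of `parHi 5`, with
  positive derivative on `[parLo 5, parHi 5]` and values in `[-3/8, 3/8]` there (two monotone
  blends with an affine middle piece, `exists_blend_deriv_pos`);
* the planar track `b.deepTrack hκ h7 h7' t` (lower turn of `αLo t` up to `parLo 5`, the tip
  `(4, tipClock t)` up to `parHi 5`, the upper turn of `αHi t` after): `C^∞`, with its zone
  formulas (`deepTrack_of_alphaLo_le`: the model neck line `(αLo t, -1)` while `αLo ≤ 7/2`, …),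
  of norm `≤ 8`, with its second coordinate separating the three zones, injective
  (`injOn_deepTrack`) and regular (`deriv_deepTrack_ne_zero`) on `[parLo (-7), parHi (-7)]`.

Everything is proved; no named facts are introduced.

## References

Standard; all statements `[folklore]`.
-/

open scoped Manifold ContDiff Topology Real
open Function Set Metric Filter

noncomputable section

namespace Literature.Topology.FourManifolds

/-- Local notation: `𝔼 n` is the model Euclidean space `EuclideanSpace ℝ (Fin n)`. -/
local notation "𝔼 " n:arg => EuclideanSpace ℝ (Fin n)

/-- Local notation: `𝕊 n` is the unit sphere in `EuclideanSpace ℝ (Fin (n + 1))`. -/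
local notation "𝕊 " n:arg => (Metric.sphere (0 : EuclideanSpace ℝ (Fin (n + 1))) 1)

/-! ### The turn profiles -/

/-- The step of the first coordinate of the turn. [folklore] -/
def turnS (a : ℝ) : ℝ := smoothStep (7 / 2) 4 a

/-- The step of the second coordinate of the turn. [folklore] -/
def turnT (a : ℝ) : ℝ := smoothStep (15 / 4) (9 / 2) a

/-- **First coordinate of the turn**: `a + (4 - a) S a`. [folklore] -/
def turnX (a : ℝ) : ℝ := a + (4 - a) * turnS a

/-- **Second coordinate of the lower turn**: `-1 + (a - 15/4) T a / 2`. [folklore] -/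
def turnV (a : ℝ) : ℝ := -1 + (a - 15 / 4) * turnT a / 2

/-- The steps are `C^∞`. [folklore] -/
theorem contDiff_turnS : ContDiff ℝ ∞ turnS := contDiff_smoothStep _ _

/-- The steps are `C^∞`. [folklore] -/
theorem contDiff_turnT : ContDiff ℝ ∞ turnT := contDiff_smoothStep _ _

/-- The first coordinate of the turn is `C^∞`. [folklore] -/
theorem contDiff_turnX : ContDiff ℝ ∞ turnX :=
  contDiff_id.add ((contDiff_const.sub contDiff_id).mul contDiff_turnS)

/-- The second coordinate of the turn is `C^∞`. [folklore] -/
theorem contDiff_turnV : ContDiff ℝ ∞ turnV :=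
  contDiff_const.add (((contDiff_id.sub contDiff_const).mul contDiff_turnT).div_const _)

/-- The steps take values in `[0, 1]`. [folklore] -/
theorem turnS_mem (a : ℝ) : turnS a ∈ Icc (0 : ℝ) 1 := smoothStep_mem_Icc _ _ _

/-- The steps take values in `[0, 1]`. [folklore] -/
theorem turnT_mem (a : ℝ) : turnT a ∈ Icc (0 : ℝ) 1 := smoothStep_mem_Icc _ _ _

/-- Left of `7/2` the first step vanishes. [folklore] -/
theorem turnS_of_le {a : ℝ} (h : a ≤ 7 / 2) : turnS a = 0 := smoothStep_of_le (by norm_num) h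

/-- Right of `4` the first step is `1`. [folklore] -/
theorem turnS_of_ge {a : ℝ} (h : 4 ≤ a) : turnS a = 1 := smoothStep_of_ge (by norm_num) h

/-- Left of `15/4` the second step vanishes. [folklore] -/
theorem turnT_of_le {a : ℝ} (h : a ≤ 15 / 4) : turnT a = 0 := smoothStep_of_le (by norm_num) h

/-- Right of `9/2` the second step is `1`. [folklore] -/
theorem turnT_of_ge {a : ℝ} (h : 9 / 2 ≤ a) : turnT a = 1 := smoothStep_of_ge (by norm_num) h

/-- **Left of `7/2` the turn runs along the neck line**: `turnX a = a`. [folklore] -/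
theorem turnX_of_le {a : ℝ} (h : a ≤ 7 / 2) : turnX a = a := by rw [turnX, turnS_of_le h]; ring

/-- **Right of `4` the turn is on the vertical line**: `turnX a = 4`. [folklore] -/
theorem turnX_of_ge {a : ℝ} (h : 4 ≤ a) : turnX a = 4 := by rw [turnX, turnS_of_ge h]; ring

/-- Left of `15/4` the second coordinate is `-1`. [folklore] -/
theorem turnV_of_le {a : ℝ} (h : a ≤ 15 / 4) : turnV a = -1 := by rw [turnV, turnT_of_le h]; ring

/-- Right of `9/2` the second coordinate is affine of slope `1/2`. [folklore] -/
theorem turnV_of_ge {a : ℝ} (h : 9 / 2 ≤ a) : turnV a = -1 + (a - 15 / 4) / 2 := by rw [turnV, turnT_of_ge h]; ring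

/-- For `a ≤ 4` the first coordinate lies in `[a, 4]`. [folklore] -/
theorem turnX_mem_of_le {a : ℝ} (h : a ≤ 4) : turnX a ∈ Icc a 4 := by
  have hS := turnS_mem a
  have h1 : 0 ≤ (4 - a) * turnS a := mul_nonneg (by linarith) hS.1
  have h2 : (4 - a) * turnS a ≤ (4 - a) * 1 := mul_le_mul_of_nonneg_left hS.2 (by linarith)
  exact ⟨by rw [turnX]; linarith, by rw [turnX]; linarith⟩

/-- For `4 ≤ a` the first coordinate lies in `[4, a]` (it is `4`, see `turnX_of_ge`). [folklore] -/
theorem turnX_le_of_ge {a : ℝ} (h : 4 ≤ a) : 4 ≤ turnX a ∧ turnX a ≤ a := by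
  have hS := turnS_mem a
  rw [turnX]; constructor <;> nlinarith [hS.1, hS.2]

/-- **The first coordinate lies in `[3, 5]` on `[3, 5]`** (crude bound). [folklore] -/
theorem turnX_mem {a : ℝ} (h : a ∈ Icc (3 : ℝ) 5) : turnX a ∈ Icc (3 : ℝ) 5 := by
  rcases le_or_gt a 4 with h4 | h4
  · have := turnX_mem_of_le h4; exact ⟨by linarith [this.1, h.1], by linarith [this.2]⟩
  · have := turnX_le_of_ge h4.le; exact ⟨by linarith [this.1], by linarith [this.2, h.2]⟩

/-- The first coordinate is at most `5` on `(-∞, 5]`. [folklore] -/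
theorem turnX_le_five {a : ℝ} (h : a ≤ 5) : turnX a ≤ 5 := by
  rcases le_or_gt a 4 with h4 | h4
  · linarith [(turnX_mem_of_le h4).2]
  · linarith [(turnX_le_of_ge h4.le).2]

/-- **The second coordinate lies in `[-1, -3/8]` on `(-∞, 5]`.** [folklore] -/
theorem turnV_mem {a : ℝ} (h : a ≤ 5) : turnV a ∈ Icc (-1 : ℝ) (-(3 / 8)) := by
  have hT := turnT_mem a
  rcases le_or_gt a (15 / 4) with h1 | h1
  · rw [turnV_of_le h1]; norm_num
  · rw [turnV]
    have h2 : 0 ≤ (a - 15 / 4) * turnT a := mul_nonneg (by linarith) hT.1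
    have h3 : (a - 15 / 4) * turnT a ≤ 5 / 4 * 1 := mul_le_mul (by linarith) hT.2 hT.1 (by norm_num)
    exact ⟨by linarith, by linarith⟩

/-- The derivative of the first coordinate: `1 - S a + (4 - a) S' a`. [folklore] -/
theorem hasDerivAt_turnX (a : ℝ) : HasDerivAt turnX (1 - turnS a + (4 - a) * deriv turnS a) a := by
  have hS : HasDerivAt turnS (deriv turnS a) a := ((contDiff_turnS.differentiable (by simp)) a).hasDerivAt
  have h := (hasDerivAt_id a).add (((hasDerivAt_id a).const_sub 4).mul hS)
  exact h.congr_deriv (by simp; ring)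

/-- The derivative of the second coordinate: `(T a + (a - 15/4) T' a) / 2`. [folklore] -/
theorem hasDerivAt_turnV (a : ℝ) : HasDerivAt turnV ((turnT a + (a - 15 / 4) * deriv turnT a) / 2) a := by
  have hT : HasDerivAt turnT (deriv turnT a) a := ((contDiff_turnT.differentiable (by simp)) a).hasDerivAt
  have h := ((((hasDerivAt_id a).sub_const (15 / 4)).mul hT).div_const 2).const_add (-1)
  exact h.congr_deriv (by simp)

/-- **The first coordinate has positive derivative left of `4`.** [folklore] -/
theorem deriv_turnX_pos {a : ℝ} (h : a < 4) : 0 < deriv turnX a := by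
  rw [(hasDerivAt_turnX a).deriv]
  have hS := turnS_mem a
  have hS' : 0 ≤ deriv turnS a := deriv_smoothStep_nonneg (by norm_num) a
  have hlt : turnS a < 1 := by
    rcases le_or_gt a (7 / 2) with h1 | h1
    · rw [turnS_of_le h1]; norm_num
    · exact (smoothStep_mem_Ioo (show (7 / 2 : ℝ) < 4 by norm_num) ⟨h1, h⟩).2
  have : 0 ≤ (4 - a) * deriv turnS a := mul_nonneg (by linarith) hS'
  linarith

/-- Right of `4` the first coordinate has derivative `0`. [folklore] -/
theorem deriv_turnX_of_gt {a : ℝ} (h : 4 < a) : deriv turnX a = 0 := by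
  have hev : turnX =ᶠ[𝓝 a] fun _ ↦ (4 : ℝ) := by
    filter_upwards [Ioi_mem_nhds h] with x hx using turnX_of_ge hx.le
  rw [hev.deriv_eq]; simp

/-- **The second coordinate has positive derivative right of `15/4`.** [folklore] -/
theorem deriv_turnV_pos {a : ℝ} (h : 15 / 4 < a) : 0 < deriv turnV a := by
  rw [(hasDerivAt_turnV a).deriv]
  have hT' : 0 ≤ deriv turnT a := deriv_smoothStep_nonneg (by norm_num) a
  have hT : 0 < turnT a := by
    rcases lt_or_ge a (9 / 2) with h1 | h1
    · exact (smoothStep_mem_Ioo (show (15 / 4 : ℝ) < 9 / 2 by norm_num) ⟨h, h1⟩).1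
    · rw [turnT_of_ge h1]; norm_num
  nlinarith

/-- Left of `15/4` the second coordinate has derivative `0`. [folklore] -/
theorem deriv_turnV_of_lt {a : ℝ} (h : a < 15 / 4) : deriv turnV a = 0 := by
  have hev : turnV =ᶠ[𝓝 a] fun _ ↦ (-1 : ℝ) := by
    filter_upwards [Iio_mem_nhds h] with x hx using turnV_of_le hx.le
  rw [hev.deriv_eq]; simp

/-- The second coordinate is monotone. [folklore] -/
theorem monotone_turnV : Monotone turnV := by
  refine monotone_of_deriv_nonneg (contDiff_turnV.differentiable (by simp)) fun a ↦ ?_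
  rcases lt_or_ge a (15 / 4) with h | h
  · rw [deriv_turnV_of_lt h]
  · rcases h.eq_or_lt with h | h
    · rw [← h, (hasDerivAt_turnV _).deriv, turnT_of_le le_rfl]
      have : deriv turnT (15 / 4) = 0 := deriv_smoothStep_left (15 / 4 : ℝ) (9 / 2)
      rw [this]; norm_num
    · exact (deriv_turnV_pos h).le

/-- The second coordinate is strictly increasing on `[15/4, ∞)`. [folklore] -/
theorem strictMonoOn_turnV : StrictMonoOn turnV (Ici (15 / 4)) := by
  refine strictMonoOn_of_deriv_pos (convex_Ici _) contDiff_turnV.continuous.continuousOn fun a ha ↦ ?_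
  rw [interior_Ici] at ha
  exact deriv_turnV_pos ha

/-- The first coordinate is strictly increasing on `(-∞, 4]`. [folklore] -/
theorem strictMonoOn_turnX : StrictMonoOn turnX (Iic 4) := by
  refine strictMonoOn_of_deriv_pos (convex_Iic _) contDiff_turnX.continuous.continuousOn fun a ha ↦ ?_
  rw [interior_Iic] at ha
  exact deriv_turnX_pos ha

/-- **The lower turn is injective on `(-∞, 5]`** (any two parameters). [folklore] -/
theorem turn_injective {a a' : ℝ} (ha : a ≤ 5) (ha' : a' ≤ 5) (hX : turnX a = turnX a') (hV : turnV a = turnV a') :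
    a = a' := by
  by_contra hne
  wlog hlt : a < a' generalizing a a'
  · exact this ha' ha hX.symm hV.symm (Ne.symm hne) (lt_of_le_of_ne (not_lt.1 hlt) (Ne.symm hne))
  rcases le_or_gt a' 4 with h1 | h1
  · exact absurd hX (strictMonoOn_turnX (show a ∈ Iic (4 : ℝ) from le_trans hlt.le h1) h1 hlt).ne
  · -- `a' > 4 > 15/4`: the second coordinate is strictly larger at `a'`
    have h2 : turnV a < turnV a' := by
      rcases le_or_gt a (15 / 4) with h3 | h3
      · rw [turnV_of_le h3]
        have := strictMonoOn_turnV (show (15 / 4 : ℝ) ∈ Ici (15 / 4) from self_mem_Ici) (show a' ∈ Ici (15 / 4 : ℝ) by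
          simp only [mem_Ici]; linarith) (by linarith)
        rwa [turnV_of_le le_rfl] at this
      · exact strictMonoOn_turnV (show a ∈ Ici (15 / 4 : ℝ) from h3.le) (show a' ∈ Ici (15 / 4 : ℝ) by
          simp only [mem_Ici]; linarith) hlt
    exact absurd hV h2.ne

/-- **The lower turn is regular**: the two derivatives never vanish together. [folklore] -/
theorem deriv_turn_ne_zero (a : ℝ) : deriv turnX a ≠ 0 ∨ deriv turnV a ≠ 0 := by
  rcases lt_or_ge a 4 with h | h
  · exact Or.inl (deriv_turnX_pos h).ne'
  · exact Or.inr (deriv_turnV_pos (by linarith)).ne'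

/-- **The lower turn** as a planar path. [folklore] -/
def lowerTurn (a : ℝ) : 𝔼 2 := pt2 (turnX a) (turnV a)

/-- **The upper turn** (mirror image in the middle line). [folklore] -/
def upperTurn (a : ℝ) : 𝔼 2 := pt2 (turnX a) (-turnV a)

/-- Coordinates of the lower turn. [folklore] -/
@[simp] theorem lowerTurn_apply_zero (a : ℝ) : lowerTurn a 0 = turnX a := rfl

/-- Coordinates of the lower turn. [folklore] -/
@[simp] theorem lowerTurn_apply_one (a : ℝ) : lowerTurn a 1 = turnV a := rfl

/-- Coordinates of the upper turn. [folklore] -/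
@[simp] theorem upperTurn_apply_zero (a : ℝ) : upperTurn a 0 = turnX a := rfl

/-- Coordinates of the upper turn. [folklore] -/
@[simp] theorem upperTurn_apply_one (a : ℝ) : upperTurn a 1 = -turnV a := rfl

/-- The lower turn is `C^∞`. [folklore] -/
theorem contDiff_lowerTurn : ContDiff ℝ ∞ lowerTurn := by
  rw [contDiff_euclidean]; intro i; fin_cases i
  · exact contDiff_turnX
  · exact contDiff_turnV

/-- The upper turn is `C^∞`. [folklore] -/
theorem contDiff_upperTurn : ContDiff ℝ ∞ upperTurn := by
  rw [contDiff_euclidean]; intro i; fin_cases i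
  · exact contDiff_turnX
  · exact contDiff_turnV.neg

/-- **Left of `7/2` the lower turn is the lower model neck line** `(a, -1)`. [folklore] -/
theorem lowerTurn_of_le {a : ℝ} (h : a ≤ 7 / 2) : lowerTurn a = pt2 a (-1) := by
  rw [lowerTurn, turnX_of_le h, turnV_of_le (by linarith)]

/-- Left of `7/2` the upper turn is the upper model neck line `(a, 1)`. [folklore] -/
theorem upperTurn_of_le {a : ℝ} (h : a ≤ 7 / 2) : upperTurn a = pt2 a 1 := by
  rw [upperTurn, turnX_of_le h, turnV_of_le (by linarith), neg_neg]

/-- **Right of `9/2` the lower turn is on the vertical line** with affine second coordinate.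
[folklore] -/
theorem lowerTurn_of_ge {a : ℝ} (h : 9 / 2 ≤ a) : lowerTurn a = pt2 4 (-1 + (a - 15 / 4) / 2) := by
  rw [lowerTurn, turnX_of_ge (by linarith), turnV_of_ge h]

/-- Right of `9/2` the upper turn is on the vertical line. [folklore] -/
theorem upperTurn_of_ge {a : ℝ} (h : 9 / 2 ≤ a) : upperTurn a = pt2 4 (1 - (a - 15 / 4) / 2) := by
  rw [upperTurn, turnX_of_ge (by linarith), turnV_of_ge h]; congr 1; ring

/-- The derivative of the lower turn. [folklore] -/
theorem hasDerivAt_lowerTurn (a : ℝ) : HasDerivAt lowerTurn (pt2 (deriv turnX a) (deriv turnV a)) a :=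
  hasDerivAt_pt2 ((contDiff_turnX.differentiable (by simp)) a).hasDerivAt ((contDiff_turnV.differentiable (by simp)) a).hasDerivAt

/-- The derivative of the upper turn. [folklore] -/
theorem hasDerivAt_upperTurn (a : ℝ) : HasDerivAt upperTurn (pt2 (deriv turnX a) (-deriv turnV a)) a :=
  hasDerivAt_pt2 ((contDiff_turnX.differentiable (by simp)) a).hasDerivAt ((contDiff_turnV.differentiable (by simp)) a).hasDerivAt.neg

/-- The derivative of the lower turn is nonzero. [folklore] -/
theorem deriv_lowerTurn_ne_zero (a : ℝ) : deriv lowerTurn a ≠ 0 := by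
  rw [(hasDerivAt_lowerTurn a).deriv]
  intro h
  have h0 : deriv turnX a = 0 := by simpa using congrArg (fun p : 𝔼 2 ↦ p 0) h
  have h1 : deriv turnV a = 0 := by simpa using congrArg (fun p : 𝔼 2 ↦ p 1) h
  rcases deriv_turn_ne_zero a with h' | h' <;> contradiction

/-- The derivative of the upper turn is nonzero. [folklore] -/
theorem deriv_upperTurn_ne_zero (a : ℝ) : deriv upperTurn a ≠ 0 := by
  rw [(hasDerivAt_upperTurn a).deriv]
  intro h
  have h0 : deriv turnX a = 0 := by simpa using congrArg (fun p : 𝔼 2 ↦ p 0) h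
  have h1 : -deriv turnV a = 0 := by simpa using congrArg (fun p : 𝔼 2 ↦ p 1) h
  rcases deriv_turn_ne_zero a with h' | h'
  · contradiction
  · exact h' (neg_eq_zero.1 h1)

/-- The lower turn is injective on `(-∞, 5]`. [folklore] -/
theorem injOn_lowerTurn : InjOn lowerTurn (Iic 5) := fun a ha a' ha' h ↦
  turn_injective ha ha' (by simpa using congrArg (fun p : 𝔼 2 ↦ p 0) h) (by simpa using congrArg (fun p : 𝔼 2 ↦ p 1) h)

/-- The upper turn is injective on `(-∞, 5]`. [folklore] -/
theorem injOn_upperTurn : InjOn upperTurn (Iic 5) := fun a ha a' ha' h ↦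
  turn_injective ha ha' (by simpa using congrArg (fun p : 𝔼 2 ↦ p 0) h)
    (neg_injective (by simpa using congrArg (fun p : 𝔼 2 ↦ p 1) h))

/-- The norm of the lower turn is at most `6` on `[-5, 5]`. [folklore] -/
theorem norm_lowerTurn_le {a : ℝ} (h : a ∈ Icc (-5 : ℝ) 5) : ‖lowerTurn a‖ ≤ 6 := by
  refine (BandData.norm_pt2_le _ _).trans ?_
  have hV := turnV_mem h.2
  have h1 : |turnV a| ≤ 1 := abs_le.2 ⟨by linarith [hV.1], by linarith [hV.2]⟩
  have h2 : |turnX a| ≤ 5 := by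
    rcases le_or_gt a 4 with h4 | h4
    · have := turnX_mem_of_le h4; exact abs_le.2 ⟨by linarith [this.1, h.1], by linarith [this.2]⟩
    · have := turnX_le_of_ge h4.le; exact abs_le.2 ⟨by linarith [this.1], by linarith [this.2, h.2]⟩
  linarith

/-- The norm of the upper turn is at most `6` on `[-5, 5]`. [folklore] -/
theorem norm_upperTurn_le {a : ℝ} (h : a ∈ Icc (-5 : ℝ) 5) : ‖upperTurn a‖ ≤ 6 := by
  have e : ‖upperTurn a‖ = ‖lowerTurn a‖ := by
    rw [EuclideanSpace.norm_eq, EuclideanSpace.norm_eq]; simp [Fin.sum_univ_two, upperTurn, lowerTurn]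
  rw [e]; exact norm_lowerTurn_le h

namespace BandData

variable {A B K : Knot} {avoid : Set (𝕊 3)} (b : BandData A B K avoid) {κ : ℝ} (hκ : 0 < κ)
  (h7 : 7 * κ ≤ b.gapLo) (h7' : 7 * κ ≤ b.gapHi)

/-! ### Levels -/

omit b in
/-- `5 ∈ [-7, 7]`. [folklore] -/
theorem five_mem : (5 : ℝ) ∈ Icc (-7 : ℝ) 7 := ⟨by norm_num, by norm_num⟩

omit b in
/-- `21/4 ∈ [-7, 7]`. [folklore] -/
theorem twentyone_mem : (21 / 4 : ℝ) ∈ Icc (-7 : ℝ) 7 := ⟨by norm_num, by norm_num⟩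

omit b in
/-- `9/2 ∈ [-7, 7]`. [folklore] -/
theorem nine_halves_mem : (9 / 2 : ℝ) ∈ Icc (-7 : ℝ) 7 := ⟨by norm_num, by norm_num⟩

omit b in
/-- `-7 ∈ [-7, 7]`. [folklore] -/
theorem neg_seven_mem : (-7 : ℝ) ∈ Icc (-7 : ℝ) 7 := ⟨by norm_num, by norm_num⟩

include hκ

/-! ### The tip clock -/
set_option maxHeartbeats 400000 in -- buildfix (bf3-g27): 160k/180k FAIL, 200k PASS at accept time; line-neutral budget line
/-- **Existence of the tip clock.** [folklore] -/
theorem exists_tipClock :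
    ∃ m : ℝ → ℝ, ContDiff ℝ ∞ m ∧
      (∀ t, t ≤ b.parLo hκ h7 five_mem → m t = -1 + (b.alphaLo κ t - 15 / 4) / 2) ∧
      (∀ t, b.parHi hκ h7' five_mem ≤ t → m t = 1 - (b.alphaHi κ t - 15 / 4) / 2) ∧
      (∀ t ∈ Icc (b.parLo hκ h7 five_mem) (b.parHi hκ h7' five_mem), 0 < deriv m t) ∧
      ∀ t ∈ Icc (b.parLo hκ h7 five_mem) (b.parHi hκ h7' five_mem), m t ∈ Icc (-(3 / 8) : ℝ) (3 / 8) := by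
  set l₅ := b.parLo hκ h7 five_mem with hl₅
  set l₆ := b.parLo hκ h7 twentyone_mem with hl₆
  set u₆ := b.parHi hκ h7' twentyone_mem with hu₆
  set u₅ := b.parHi hκ h7' five_mem with hu₅
  have hl : l₅ < l₆ := b.parLo_lt_parLo hκ h7 five_mem twentyone_mem (by norm_num)
  have hu : u₆ < u₅ := b.parHi_lt_parHi hκ h7' five_mem twentyone_mem (by norm_num)
  have hlu : l₆ < u₆ := b.parLo_lt_parHi hκ h7 h7' twentyone_mem twentyone_mem
  set p₁ : ℝ → ℝ := fun t ↦ -1 + (b.alphaLo κ t - 15 / 4) / 2 with hp₁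
  set p₃ : ℝ → ℝ := fun t ↦ 1 - (b.alphaHi κ t - 15 / 4) / 2 with hp₃
  set N : ℝ := (1 / 2) / (u₅ - l₅) with hN
  have hN0 : 0 < N := div_pos (by norm_num) (by linarith)
  set ℓ : ℝ → ℝ := fun t ↦ -(1 / 4) + N * (t - l₅) with hℓ
  have hp₁s : ContDiff ℝ ∞ p₁ := contDiff_const.add (((b.contDiff_alphaLo κ).sub contDiff_const).div_const _)
  have hp₃s : ContDiff ℝ ∞ p₃ := contDiff_const.sub (((b.contDiff_alphaHi κ).sub contDiff_const).div_const _)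
  have hℓs : ContDiff ℝ ∞ ℓ := contDiff_const.add (contDiff_const.mul (contDiff_id.sub contDiff_const))
  have hℓD : ∀ t, HasDerivAt ℓ N t := fun t ↦ by
    have h := (((hasDerivAt_id t).sub_const l₅).const_mul N).const_add (-(1 / 4))
    rw [mul_one] at h
    exact h
  have hℓd : ∀ t, deriv ℓ t = N := fun t ↦ (hℓD t).deriv
  have hp₁d : ∀ t, deriv p₁ t = deriv b.chiLo t / κ / 2 := fun t ↦ by
    have := ((b.hasDerivAt_alphaLo κ t).sub_const (15 / 4)).div_const 2 |>.const_add (-1)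
    rw [this.deriv]
  have hp₃d : ∀ t, deriv p₃ t = -(deriv b.chiHi t / κ / 2) := fun t ↦ by
    have := ((b.hasDerivAt_alphaHi κ t).sub_const (15 / 4)).div_const 2 |>.const_sub 1
    rw [this.deriv]
  -- values at the marks
  have hl₅c : l₅ ∈ Icc (b.tcLo - b.epsLo / 8) (b.tcLo + b.epsLo / 8) := b.parLo_mem_core hκ h7 five_mem
  have hl₆c : l₆ ∈ Icc (b.tcLo - b.epsLo / 8) (b.tcLo + b.epsLo / 8) := b.parLo_mem_core hκ h7 twentyone_mem
  have hu₅c : u₅ ∈ Icc (b.tcHi - b.epsHi / 8) (b.tcHi + b.epsHi / 8) := b.parHi_mem_core hκ h7' five_mem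
  have hu₆c : u₆ ∈ Icc (b.tcHi - b.epsHi / 8) (b.tcHi + b.epsHi / 8) := b.parHi_mem_core hκ h7' twentyone_mem
  have eN : N * (u₅ - l₅) = 1 / 2 := by rw [hN]; exact div_mul_cancel₀ _ (by linarith)
  have v₁ : p₁ l₆ = -(1 / 4) := by
    have e := b.alphaLo_parLo hκ h7 twentyone_mem
    simp only [hp₁, hl₆, e]; norm_num
  have v₃ : p₃ u₆ = 1 / 4 := by
    have e := b.alphaHi_parHi hκ h7' twentyone_mem
    simp only [hp₃, hu₆, e]; norm_num
  have vℓ₁ : ℓ l₅ = -(1 / 4) := by simp [hℓ]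
  have vℓ₂ : ℓ u₅ = 1 / 4 := by
    show -(1 / 4) + N * (u₅ - l₅) = 1 / 4
    rw [eN]; norm_num
  -- first blend on `[l₅, l₆]`
  have hle₁ : ∀ t ∈ Icc l₅ l₆, p₁ t ≤ ℓ t := by
    intro t ht
    have h1 : p₁ t ≤ p₁ l₆ := by
      simp only [hp₁]
      have : b.alphaLo κ t ≤ 21 / 4 := (b.alphaLo_le_iff' hκ h7 twentyone_mem ⟨by linarith [ht.1, hl₅c.1], by linarith [ht.2, hl₆c.2]⟩).2 ht.2
      have e : b.alphaLo κ l₆ = 21 / 4 := b.alphaLo_parLo hκ h7 twentyone_mem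
      rw [e]; linarith
    have h2 : ℓ l₅ ≤ ℓ t := by simp only [hℓ]; nlinarith [ht.1]
    linarith
  have hd₁ : ∀ t ∈ Icc l₅ l₆, 0 < deriv p₁ t := fun t ht ↦ by
    rw [hp₁d]; exact div_pos (div_pos (b.deriv_chiLo_pos ⟨by linarith [ht.1, hl₅c.1], by linarith [ht.2, hl₆c.2]⟩) hκ) two_pos
  obtain ⟨H₁, hH₁s, hH₁l, hH₁r, hH₁d, hH₁u⟩ := exists_blend_deriv_pos hl hp₁s hℓs hle₁ hd₁ (fun t _ ↦ by rw [hℓd t]; exact hN0)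
  -- second blend on `[u₆, u₅]`
  have hle₂ : ∀ t ∈ Icc u₆ u₅, H₁ t ≤ p₃ t := by
    intro t ht
    rw [hH₁r t (by linarith [ht.1])]
    have h1 : ℓ t ≤ ℓ u₅ := by simp only [hℓ]; nlinarith [ht.2]
    have h2 : p₃ u₆ ≤ p₃ t := by
      simp only [hp₃]
      have : b.alphaHi κ t ≤ 21 / 4 := (b.alphaHi_le_iff' hκ h7' twentyone_mem ⟨by linarith [ht.1, hu₆c.1], by linarith [ht.2, hu₅c.2]⟩).2 ht.1
      have e : b.alphaHi κ u₆ = 21 / 4 := b.alphaHi_parHi hκ h7' twentyone_mem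
      rw [e]; linarith
    linarith
  have hd₂ : ∀ t ∈ Icc u₆ u₅, 0 < deriv H₁ t := fun t ht ↦ by
    have hev : H₁ =ᶠ[𝓝 t] ℓ := by
      filter_upwards [Ioi_mem_nhds (show l₆ < t by linarith [ht.1])] with s hs using hH₁r s hs.le
    rw [hev.deriv_eq, hℓd]; exact hN0
  have hd₃ : ∀ t ∈ Icc u₆ u₅, 0 < deriv p₃ t := fun t ht ↦ by
    rw [hp₃d]
    have hneg := b.deriv_chiHi_neg (t := t) ⟨by linarith [ht.1, hu₆c.1], by linarith [ht.2, hu₅c.2]⟩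
    have : deriv b.chiHi t / κ / 2 < 0 := div_neg_of_neg_of_pos (div_neg_of_neg_of_pos hneg hκ) two_pos
    linarith
  obtain ⟨H₂, hH₂s, hH₂l, hH₂r, hH₂d, hH₂u⟩ := exists_blend_deriv_pos hu hH₁s hp₃s hle₂ hd₂ hd₃
  refine ⟨H₂, hH₂s, fun t ht ↦ ?_, fun t ht ↦ hH₂r t ht, fun t ht ↦ ?_, fun t ht ↦ ?_⟩
  · rw [hH₂l t (by linarith), hH₁l t ht]
  · -- positivity of the derivative on `[l₅, u₅]`
    rcases le_or_gt t l₆ with h1 | h1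
    · have hev : H₂ =ᶠ[𝓝 t] H₁ := by
        filter_upwards [Iio_mem_nhds (show t < u₆ by linarith)] with s hs using hH₂l s hs.le
      rw [hev.deriv_eq]; exact hH₁d t ⟨ht.1, h1⟩
    rcases lt_or_ge t u₆ with h2 | h2
    · have hev : H₂ =ᶠ[𝓝 t] ℓ := by
        filter_upwards [Iio_mem_nhds h2, Ioi_mem_nhds h1] with s hs hs'
        rw [hH₂l s hs.le, hH₁r s hs'.le]
      rw [hev.deriv_eq, hℓd]; exact hN0
    · exact hH₂d t ⟨h2, ht.2⟩
  · -- values in `[-3/8, 3/8]`: everything is squeezed between `p₁`, `ℓ`, `p₃`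
    have hℓm : ℓ t ∈ Icc (-(1 / 4) : ℝ) (1 / 4) := by
      show -(1 / 4) + N * (t - l₅) ∈ Icc (-(1 / 4) : ℝ) (1 / 4)
      constructor <;> nlinarith [ht.1, ht.2, eN, hN0]
    rcases le_or_gt t l₆ with h1 | h1
    · rw [hH₂l t (by linarith)]
      have hu1 := hH₁u t
      have hp : p₁ t ∈ Icc (-(3 / 8) : ℝ) (-(1 / 4)) := by
        simp only [hp₁, mem_Icc]
        have hc : t ∈ Icc (b.tcLo - b.epsLo / 8) (b.tcLo + b.epsLo / 8) := ⟨by linarith [ht.1, hl₅c.1], by linarith [hl₆c.2]⟩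
        have a1 : 5 ≤ b.alphaLo κ t := (b.le_alphaLo_iff' hκ h7 five_mem hc).2 ht.1
        have a2 : b.alphaLo κ t ≤ 21 / 4 := (b.alphaLo_le_iff' hκ h7 twentyone_mem hc).2 h1
        constructor <;> linarith
      rcases mem_uIcc.1 hu1 with h | h
      · exact ⟨by linarith [h.1, hp.1], by linarith [h.2, hℓm.2]⟩
      · exact ⟨by linarith [h.1, hℓm.1], by linarith [h.2, hp.2]⟩
    rcases lt_or_ge t u₆ with h2 | h2
    · rw [hH₂l t h2.le, hH₁r t h1.le]
      exact ⟨by linarith [hℓm.1], by linarith [hℓm.2]⟩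
    · have hu2 := hH₂u t
      rw [hH₁r t (by linarith)] at hu2
      have hp : p₃ t ∈ Icc (1 / 4 : ℝ) (3 / 8) := by
        simp only [hp₃, mem_Icc]
        have hc : t ∈ Icc (b.tcHi - b.epsHi / 8) (b.tcHi + b.epsHi / 8) := ⟨by linarith [hu₆c.1], by linarith [ht.2, hu₅c.2]⟩
        have a1 : 5 ≤ b.alphaHi κ t := (b.le_alphaHi_iff' hκ h7' five_mem hc).2 ht.2
        have a2 : b.alphaHi κ t ≤ 21 / 4 := (b.alphaHi_le_iff' hκ h7' twentyone_mem hc).2 h2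
        constructor <;> linarith
      rcases mem_uIcc.1 hu2 with h | h
      · exact ⟨by linarith [h.1, hℓm.1], by linarith [h.2, hp.2]⟩
      · exact ⟨by linarith [h.1, hp.1], by linarith [h.2, hℓm.2]⟩

/-- **The tip clock** (chosen). [folklore] -/
def tipClock : ℝ → ℝ := (b.exists_tipClock hκ h7 h7').choose

/-- The tip clock is `C^∞`. [folklore] -/
theorem contDiff_tipClock : ContDiff ℝ ∞ (b.tipClock hκ h7 h7') := (b.exists_tipClock hκ h7 h7').choose_spec.1

/-- Left of `parLo 5` the tip clock continues the lower turn. [folklore] -/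
theorem tipClock_of_le {t : ℝ} (ht : t ≤ b.parLo hκ h7 five_mem) :
    b.tipClock hκ h7 h7' t = -1 + (b.alphaLo κ t - 15 / 4) / 2 := (b.exists_tipClock hκ h7 h7').choose_spec.2.1 t ht

/-- Right of `parHi 5` the tip clock continues the upper turn. [folklore] -/
theorem tipClock_of_ge {t : ℝ} (ht : b.parHi hκ h7' five_mem ≤ t) :
    b.tipClock hκ h7 h7' t = 1 - (b.alphaHi κ t - 15 / 4) / 2 := (b.exists_tipClock hκ h7 h7').choose_spec.2.2.1 t ht

/-- The tip clock has positive derivative between the marks. [folklore] -/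
theorem deriv_tipClock_pos {t : ℝ} (ht : t ∈ Icc (b.parLo hκ h7 five_mem) (b.parHi hκ h7' five_mem)) :
    0 < deriv (b.tipClock hκ h7 h7') t := (b.exists_tipClock hκ h7 h7').choose_spec.2.2.2.1 t ht

/-- The tip clock takes values in `[-3/8, 3/8]` between the marks. [folklore] -/
theorem tipClock_mem {t : ℝ} (ht : t ∈ Icc (b.parLo hκ h7 five_mem) (b.parHi hκ h7' five_mem)) :
    b.tipClock hκ h7 h7' t ∈ Icc (-(3 / 8) : ℝ) (3 / 8) := (b.exists_tipClock hκ h7 h7').choose_spec.2.2.2.2 t ht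

/-- The tip clock is strictly increasing between the marks. [folklore] -/
theorem strictMonoOn_tipClock : StrictMonoOn (b.tipClock hκ h7 h7') (Icc (b.parLo hκ h7 five_mem) (b.parHi hκ h7' five_mem)) :=
  strictMonoOn_of_deriv_pos (convex_Icc _ _) (b.contDiff_tipClock hκ h7 h7').continuous.continuousOn fun _ ht ↦
    b.deriv_tipClock_pos hκ h7 h7' (interior_subset ht)

/-! ### The planar track -/

/-- **The planar track of the deep arc** (relative to the centre, blow-up units): the lower turn of
`αLo t` up to `parLo 5`, the tip `(4, tipClock t)` up to `parHi 5`, the upper turn of `αHi t`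
after. [folklore] -/
def deepTrack (t : ℝ) : 𝔼 2 :=
  if t ≤ b.parLo hκ h7 five_mem then lowerTurn (b.alphaLo κ t)
  else if t < b.parHi hκ h7' five_mem then pt2 4 (b.tipClock hκ h7 h7' t)
  else upperTurn (b.alphaHi κ t)

/-- Left of `parLo 5` the track is the lower turn. [folklore] -/
theorem deepTrack_of_le {t : ℝ} (ht : t ≤ b.parLo hκ h7 five_mem) : b.deepTrack hκ h7 h7' t = lowerTurn (b.alphaLo κ t) := by
  simp [deepTrack, ht]

/-- Right of `parHi 5` the track is the upper turn. [folklore] -/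
theorem deepTrack_of_ge {t : ℝ} (ht : b.parHi hκ h7' five_mem ≤ t) : b.deepTrack hκ h7 h7' t = upperTurn (b.alphaHi κ t) := by
  have h1 : ¬ t ≤ b.parLo hκ h7 five_mem := by
    have := b.parLo_lt_parHi hκ h7 h7' five_mem five_mem; push Not; linarith
  simp [deepTrack, h1, not_lt.2 ht]

/-- Between the marks the track is the tip. [folklore] -/
theorem deepTrack_of_mem {t : ℝ} (ht : t ∈ Ioo (b.parLo hκ h7 five_mem) (b.parHi hκ h7' five_mem)) :
    b.deepTrack hκ h7 h7' t = pt2 4 (b.tipClock hκ h7 h7' t) := by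
  simp [deepTrack, not_le.2 ht.1, ht.2]

/-- **Near the lower mark the track is the tip** (both formulas agree on `[parLo (9/2), parHi 5)`).
[folklore] -/
theorem deepTrack_eq_tip_of_mem {t : ℝ} (ht : t ∈ Ico (b.parLo hκ h7 nine_halves_mem) (b.parHi hκ h7' five_mem)) :
    b.deepTrack hκ h7 h7' t = pt2 4 (b.tipClock hκ h7 h7' t) := by
  rcases le_or_gt t (b.parLo hκ h7 five_mem) with h | h
  · rw [b.deepTrack_of_le hκ h7 h7' h, b.tipClock_of_le hκ h7 h7' h]
    have hc : t ∈ Icc (b.tcLo - b.epsLo / 8) (b.tcLo + b.epsLo / 8) :=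
      ⟨by linarith [ht.1, (b.parLo_mem_core hκ h7 nine_halves_mem).1], by linarith [(b.parLo_mem_core hκ h7 five_mem).2]⟩
    have ha : 9 / 2 ≤ b.alphaLo κ t := (b.le_alphaLo_iff' hκ h7 nine_halves_mem hc).2 ht.1
    rw [lowerTurn_of_ge ha]
  · exact b.deepTrack_of_mem hκ h7 h7' ⟨h, ht.2⟩

/-- **Near the upper mark the track is the tip** (on `(parLo 5, parHi (9/2)]`). [folklore] -/
theorem deepTrack_eq_tip_of_mem' {t : ℝ} (ht : t ∈ Ioc (b.parLo hκ h7 five_mem) (b.parHi hκ h7' nine_halves_mem)) :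
    b.deepTrack hκ h7 h7' t = pt2 4 (b.tipClock hκ h7 h7' t) := by
  rcases lt_or_ge t (b.parHi hκ h7' five_mem) with h | h
  · exact b.deepTrack_of_mem hκ h7 h7' ⟨ht.1, h⟩
  · rw [b.deepTrack_of_ge hκ h7 h7' h, b.tipClock_of_ge hκ h7 h7' h]
    have hc : t ∈ Icc (b.tcHi - b.epsHi / 8) (b.tcHi + b.epsHi / 8) :=
      ⟨by linarith [(b.parHi_mem_core hκ h7' five_mem).1], by linarith [ht.2, (b.parHi_mem_core hκ h7' nine_halves_mem).2]⟩
    have ha : 9 / 2 ≤ b.alphaHi κ t := (b.le_alphaHi_iff' hκ h7' nine_halves_mem hc).2 ht.2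
    rw [upperTurn_of_ge ha]

/-- **On the lower neck zone the track is the model neck line** `(αLo t, -1)` (`αLo t ≤ 7/2`, `t` in
the lower core). [folklore] -/
theorem deepTrack_of_alphaLo_le {t : ℝ} (hc : t ∈ Icc (b.tcLo - b.epsLo / 8) (b.tcLo + b.epsLo / 8))
    (ha : b.alphaLo κ t ≤ 7 / 2) : b.deepTrack hκ h7 h7' t = pt2 (b.alphaLo κ t) (-1) := by
  have ht : t ≤ b.parLo hκ h7 five_mem := (b.alphaLo_le_iff' hκ h7 five_mem hc).1 (by linarith)
  rw [b.deepTrack_of_le hκ h7 h7' ht, lowerTurn_of_le ha]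

/-- **On the upper neck zone the track is the model neck line** `(αHi t, 1)`. [folklore] -/
theorem deepTrack_of_alphaHi_le {t : ℝ} (hc : t ∈ Icc (b.tcHi - b.epsHi / 8) (b.tcHi + b.epsHi / 8))
    (ha : b.alphaHi κ t ≤ 7 / 2) : b.deepTrack hκ h7 h7' t = pt2 (b.alphaHi κ t) 1 := by
  have ht : b.parHi hκ h7' five_mem ≤ t := (b.alphaHi_le_iff' hκ h7' five_mem hc).1 (by linarith)
  rw [b.deepTrack_of_ge hκ h7 h7' ht, upperTurn_of_le ha]

/-- **The planar track is `C^∞`.** [folklore] -/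
theorem contDiff_deepTrack : ContDiff ℝ ∞ (b.deepTrack hκ h7 h7') := by
  have hlow : ContDiff ℝ ∞ fun t ↦ lowerTurn (b.alphaLo κ t) := contDiff_lowerTurn.comp (b.contDiff_alphaLo κ)
  have hup : ContDiff ℝ ∞ fun t ↦ upperTurn (b.alphaHi κ t) := contDiff_upperTurn.comp (b.contDiff_alphaHi κ)
  have htip : ContDiff ℝ ∞ fun t ↦ (pt2 4 (b.tipClock hκ h7 h7' t) : 𝔼 2) := by
    rw [contDiff_euclidean]; intro i; fin_cases i
    · exact contDiff_const
    · exact b.contDiff_tipClock hκ h7 h7'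
  have h45 : b.parLo hκ h7 nine_halves_mem < b.parLo hκ h7 five_mem := b.parLo_lt_parLo hκ h7 nine_halves_mem five_mem (by norm_num)
  have h45' : b.parHi hκ h7' five_mem < b.parHi hκ h7' nine_halves_mem := b.parHi_lt_parHi hκ h7' nine_halves_mem five_mem (by norm_num)
  have hlu := b.parLo_lt_parHi hκ h7 h7' five_mem five_mem
  rw [contDiff_iff_contDiffAt]
  intro t
  rcases lt_or_ge t (b.parLo hκ h7 five_mem) with h1 | h1
  · have hev : b.deepTrack hκ h7 h7' =ᶠ[𝓝 t] fun t ↦ lowerTurn (b.alphaLo κ t) := by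
      filter_upwards [Iio_mem_nhds h1] with s hs using b.deepTrack_of_le hκ h7 h7' hs.le
    exact hlow.contDiffAt.congr_of_eventuallyEq hev
  rcases le_or_gt t (b.parHi hκ h7' five_mem) with h2 | h2
  · have hev : b.deepTrack hκ h7 h7' =ᶠ[𝓝 t] fun t ↦ (pt2 4 (b.tipClock hκ h7 h7' t) : 𝔼 2) := by
      filter_upwards [Ioo_mem_nhds (show b.parLo hκ h7 nine_halves_mem < t by linarith) (show t < b.parHi hκ h7' nine_halves_mem by linarith)]
        with s hs
      rcases lt_or_ge s (b.parHi hκ h7' five_mem) with h3 | h3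
      · exact b.deepTrack_eq_tip_of_mem hκ h7 h7' ⟨hs.1.le, h3⟩
      · exact b.deepTrack_eq_tip_of_mem' hκ h7 h7' ⟨by linarith, hs.2.le⟩
    exact htip.contDiffAt.congr_of_eventuallyEq hev
  · have hev : b.deepTrack hκ h7 h7' =ᶠ[𝓝 t] fun t ↦ upperTurn (b.alphaHi κ t) := by
      filter_upwards [Ioi_mem_nhds h2] with s hs using b.deepTrack_of_ge hκ h7 h7' hs.le
    exact hup.contDiffAt.congr_of_eventuallyEq hev

/-! ### Bounds, regularity and injectivity of the planar track -/

omit hκ in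
/-- The norm of the lower turn is at most `8` on `[-7, 5]`. [folklore] -/
theorem norm_lowerTurn_le' {a : ℝ} (h : a ∈ Icc (-7 : ℝ) 5) : ‖lowerTurn a‖ ≤ 8 := by
  refine (norm_pt2_le _ _).trans ?_
  have hV := turnV_mem h.2
  have h1 : |turnV a| ≤ 1 := abs_le.2 ⟨by linarith [hV.1], by linarith [hV.2]⟩
  have h2 : |turnX a| ≤ 7 := by
    rcases le_or_gt a 4 with h4 | h4
    · have := turnX_mem_of_le h4; exact abs_le.2 ⟨by linarith [this.1, h.1], by linarith [this.2]⟩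
    · have := turnX_le_of_ge h4.le; exact abs_le.2 ⟨by linarith [this.1], by linarith [this.2, h.2]⟩
  change |turnX a| + |turnV a| ≤ 8
  linarith

omit hκ in
/-- The norm of the upper turn is at most `8` on `[-7, 5]`. [folklore] -/
theorem norm_upperTurn_le' {a : ℝ} (h : a ∈ Icc (-7 : ℝ) 5) : ‖upperTurn a‖ ≤ 8 := by
  have e : ‖upperTurn a‖ = ‖lowerTurn a‖ := by
    rw [EuclideanSpace.norm_eq, EuclideanSpace.norm_eq]; simp [Fin.sum_univ_two, upperTurn, lowerTurn]
  rw [e]; exact norm_lowerTurn_le' h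

/-- The lower zone lies in the closed lower core. [folklore] -/
theorem mem_coreLo_of_zone {t : ℝ} (ht : t ∈ Icc (b.parLo hκ h7 neg_seven_mem) (b.parLo hκ h7 five_mem)) :
    t ∈ Icc (b.tcLo - b.epsLo / 8) (b.tcLo + b.epsLo / 8) :=
  ⟨le_trans (b.parLo_mem_core hκ h7 neg_seven_mem).1 ht.1, le_trans ht.2 (b.parLo_mem_core hκ h7 five_mem).2⟩

/-- The upper zone lies in the closed upper core. [folklore] -/
theorem mem_coreHi_of_zone {t : ℝ} (ht : t ∈ Icc (b.parHi hκ h7' five_mem) (b.parHi hκ h7' neg_seven_mem)) :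
    t ∈ Icc (b.tcHi - b.epsHi / 8) (b.tcHi + b.epsHi / 8) :=
  ⟨le_trans (b.parHi_mem_core hκ h7' five_mem).1 ht.1, le_trans ht.2 (b.parHi_mem_core hκ h7' neg_seven_mem).2⟩

/-- On the lower zone `αLo ∈ [-7, 5]`. [folklore] -/
theorem alphaLo_mem_of_zone {t : ℝ} (ht : t ∈ Icc (b.parLo hκ h7 neg_seven_mem) (b.parLo hκ h7 five_mem)) :
    b.alphaLo κ t ∈ Icc (-7 : ℝ) 5 :=
  ⟨(b.le_alphaLo_iff' hκ h7 neg_seven_mem (b.mem_coreLo_of_zone hκ h7 ht)).2 ht.1,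
    (b.alphaLo_le_iff' hκ h7 five_mem (b.mem_coreLo_of_zone hκ h7 ht)).2 ht.2⟩

/-- On the upper zone `αHi ∈ [-7, 5]`. [folklore] -/
theorem alphaHi_mem_of_zone {t : ℝ} (ht : t ∈ Icc (b.parHi hκ h7' five_mem) (b.parHi hκ h7' neg_seven_mem)) :
    b.alphaHi κ t ∈ Icc (-7 : ℝ) 5 :=
  ⟨(b.le_alphaHi_iff' hκ h7' neg_seven_mem (b.mem_coreHi_of_zone hκ h7' ht)).2 ht.2,
    (b.alphaHi_le_iff' hκ h7' five_mem (b.mem_coreHi_of_zone hκ h7' ht)).2 ht.1⟩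

/-- **The planar track has norm at most `8`** on `[parLo (-7), parHi (-7)]`. [folklore] -/
theorem norm_deepTrack_le {t : ℝ} (ht : t ∈ Icc (b.parLo hκ h7 neg_seven_mem) (b.parHi hκ h7' neg_seven_mem)) :
    ‖b.deepTrack hκ h7 h7' t‖ ≤ 8 := by
  rcases le_or_gt t (b.parLo hκ h7 five_mem) with h1 | h1
  · rw [b.deepTrack_of_le hκ h7 h7' h1]
    exact norm_lowerTurn_le' (b.alphaLo_mem_of_zone hκ h7 ⟨ht.1, h1⟩)
  rcases lt_or_ge t (b.parHi hκ h7' five_mem) with h2 | h2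
  · rw [b.deepTrack_of_mem hκ h7 h7' ⟨h1, h2⟩]
    have hm := b.tipClock_mem hκ h7 h7' ⟨h1.le, h2.le⟩
    refine (norm_pt2_le _ _).trans ?_
    have : |b.tipClock hκ h7 h7' t| ≤ 1 := abs_le.2 ⟨by linarith [hm.1], by linarith [hm.2]⟩
    rw [abs_of_pos (by norm_num : (0:ℝ) < 4)]; linarith
  · rw [b.deepTrack_of_ge hκ h7 h7' h2]
    exact norm_upperTurn_le' (b.alphaHi_mem_of_zone hκ h7' ⟨h2, ht.2⟩)

/-- **The second coordinate of the track on the lower zone is `< -3/8`** (strictly left of `parLo 5`).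
[folklore] -/
theorem deepTrack_one_lt_of_lt {t : ℝ} (ht : t ∈ Ico (b.parLo hκ h7 neg_seven_mem) (b.parLo hκ h7 five_mem)) :
    b.deepTrack hκ h7 h7' t 1 < -(3 / 8) := by
  rw [b.deepTrack_of_le hκ h7 h7' ht.2.le, lowerTurn_apply_one]
  have ha : b.alphaLo κ t < 5 := (b.alphaLo_lt_iff' hκ h7 five_mem (b.mem_coreLo_of_zone hκ h7 ⟨ht.1, ht.2.le⟩)).2 ht.2
  have h5 : turnV 5 = -(3 / 8) := by rw [turnV_of_ge (by norm_num)]; norm_num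
  rcases le_or_gt (b.alphaLo κ t) (15 / 4) with h1 | h1
  · rw [turnV_of_le h1]; norm_num
  · rw [← h5]
    exact strictMonoOn_turnV (show b.alphaLo κ t ∈ Ici (15 / 4 : ℝ) from h1.le) (show (5 : ℝ) ∈ Ici (15 / 4 : ℝ) by
      simp only [mem_Ici]; norm_num) ha

/-- The second coordinate of the track on the tip zone lies in `[-3/8, 3/8]`. [folklore] -/
theorem deepTrack_one_mem_of_mem {t : ℝ} (ht : t ∈ Icc (b.parLo hκ h7 five_mem) (b.parHi hκ h7' five_mem)) :
    b.deepTrack hκ h7 h7' t 1 ∈ Icc (-(3 / 8) : ℝ) (3 / 8) := by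
  have h45 : b.parLo hκ h7 nine_halves_mem < b.parLo hκ h7 five_mem := b.parLo_lt_parLo hκ h7 nine_halves_mem five_mem (by norm_num)
  rcases lt_or_ge t (b.parHi hκ h7' five_mem) with h | h
  · rw [b.deepTrack_eq_tip_of_mem hκ h7 h7' ⟨by linarith [ht.1], h⟩]; simpa using b.tipClock_mem hκ h7 h7' ht
  · have h45' : b.parHi hκ h7' five_mem < b.parHi hκ h7' nine_halves_mem := b.parHi_lt_parHi hκ h7' nine_halves_mem five_mem (by norm_num)
    rw [b.deepTrack_eq_tip_of_mem' hκ h7 h7' ⟨by linarith [ht.1, b.parLo_lt_parHi hκ h7 h7' five_mem five_mem], by linarith [ht.2]⟩]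
    simpa using b.tipClock_mem hκ h7 h7' ht

/-- The second coordinate of the track on the tip zone is `< 3/8` left of `parHi 5`. [folklore] -/
theorem deepTrack_one_lt_of_mem {t : ℝ} (ht : t ∈ Ico (b.parLo hκ h7 five_mem) (b.parHi hκ h7' five_mem)) :
    b.deepTrack hκ h7 h7' t 1 < 3 / 8 := by
  have h45 : b.parLo hκ h7 nine_halves_mem < b.parLo hκ h7 five_mem := b.parLo_lt_parLo hκ h7 nine_halves_mem five_mem (by norm_num)
  rw [b.deepTrack_eq_tip_of_mem hκ h7 h7' ⟨by linarith [ht.1], ht.2⟩, pt2_apply_one]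
  have hm : b.tipClock hκ h7 h7' (b.parHi hκ h7' five_mem) = 3 / 8 := by
    rw [b.tipClock_of_ge hκ h7 h7' le_rfl, b.alphaHi_parHi hκ h7' five_mem]; norm_num
  rw [← hm]
  exact b.strictMonoOn_tipClock hκ h7 h7' ⟨ht.1, ht.2.le⟩ ⟨(b.parLo_lt_parHi hκ h7 h7' five_mem five_mem).le, le_rfl⟩ ht.2

/-- **The second coordinate of the track on the upper zone** is `-turnV (αHi t) ≥ 3/8`. [folklore] -/
theorem le_deepTrack_one_of_ge {t : ℝ} (ht : t ∈ Icc (b.parHi hκ h7' five_mem) (b.parHi hκ h7' neg_seven_mem)) :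
    3 / 8 ≤ b.deepTrack hκ h7 h7' t 1 := by
  rw [b.deepTrack_of_ge hκ h7 h7' ht.1, upperTurn_apply_one]
  have := (turnV_mem (b.alphaHi_mem_of_zone hκ h7' ht).2).2
  linarith

/-- **The planar track is injective on `[parLo (-7), parHi (-7)]`.** [folklore] -/
theorem injOn_deepTrack : InjOn (b.deepTrack hκ h7 h7') (Icc (b.parLo hκ h7 neg_seven_mem) (b.parHi hκ h7' neg_seven_mem)) := by
  have hl5h5 := b.parLo_lt_parHi hκ h7 h7' five_mem five_mem
  intro s hs t ht hst
  by_contra hne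
  wlog hlt : s < t generalizing s t
  · exact this ht hs hst.symm (Ne.symm hne) (lt_of_le_of_ne (not_lt.1 hlt) (Ne.symm hne))
  have hV : b.deepTrack hκ h7 h7' s 1 = b.deepTrack hκ h7 h7' t 1 := by rw [hst]
  -- zones of `s` and `t`
  rcases le_or_gt t (b.parLo hκ h7 five_mem) with ht1 | ht1
  · -- both in the lower zone
    rw [b.deepTrack_of_le hκ h7 h7' (by linarith), b.deepTrack_of_le hκ h7 h7' ht1] at hst
    have ha := injOn_lowerTurn (show b.alphaLo κ s ∈ Iic (5 : ℝ) from (b.alphaLo_mem_of_zone hκ h7 ⟨hs.1, by linarith⟩).2)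
      (show b.alphaLo κ t ∈ Iic (5 : ℝ) from (b.alphaLo_mem_of_zone hκ h7 ⟨ht.1, ht1⟩).2) hst
    have := (b.strictMonoOn_alphaLo (κ := κ) hκ) (b.mem_coreLo_of_zone hκ h7 ⟨hs.1, by linarith⟩) (b.mem_coreLo_of_zone hκ h7 ⟨ht.1, ht1⟩) hlt
    exact absurd ha this.ne
  rcases lt_or_ge s (b.parLo hκ h7 five_mem) with hs1 | hs1
  · -- `s` in the lower zone (strictly), `t` beyond: second coordinates differ
    have h1 := b.deepTrack_one_lt_of_lt hκ h7 h7' ⟨hs.1, hs1⟩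
    have h2 : -(3 / 8) ≤ b.deepTrack hκ h7 h7' t 1 := by
      rcases le_or_gt t (b.parHi hκ h7' five_mem) with ht2 | ht2
      · exact (b.deepTrack_one_mem_of_mem hκ h7 h7' ⟨ht1.le, ht2⟩).1
      · linarith [b.le_deepTrack_one_of_ge hκ h7 h7' ⟨ht2.le, ht.2⟩]
    linarith
  rcases le_or_gt t (b.parHi hκ h7' five_mem) with ht2 | ht2
  · -- both in the tip zone
    have hms := b.deepTrack_one_mem_of_mem hκ h7 h7' ⟨hs1, by linarith⟩
    have e1 : b.deepTrack hκ h7 h7' s 1 = b.tipClock hκ h7 h7' s := by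
      have h45 : b.parLo hκ h7 nine_halves_mem < b.parLo hκ h7 five_mem := b.parLo_lt_parLo hκ h7 nine_halves_mem five_mem (by norm_num)
      rw [b.deepTrack_eq_tip_of_mem hκ h7 h7' ⟨by linarith, by linarith⟩, pt2_apply_one]
    have e2 : b.deepTrack hκ h7 h7' t 1 = b.tipClock hκ h7 h7' t := by
      rcases lt_or_ge t (b.parHi hκ h7' five_mem) with h | h
      · have h45 : b.parLo hκ h7 nine_halves_mem < b.parLo hκ h7 five_mem := b.parLo_lt_parLo hκ h7 nine_halves_mem five_mem (by norm_num)
        rw [b.deepTrack_eq_tip_of_mem hκ h7 h7' ⟨by linarith, h⟩, pt2_apply_one]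
      · have h45' : b.parHi hκ h7' five_mem < b.parHi hκ h7' nine_halves_mem := b.parHi_lt_parHi hκ h7' nine_halves_mem five_mem (by norm_num)
        rw [b.deepTrack_eq_tip_of_mem' hκ h7 h7' ⟨by linarith, by linarith⟩, pt2_apply_one]
    rw [e1, e2] at hV
    exact absurd hV (b.strictMonoOn_tipClock hκ h7 h7' ⟨hs1, by linarith⟩ ⟨by linarith, ht2⟩ hlt).ne
  rcases lt_or_ge s (b.parHi hκ h7' five_mem) with hs2 | hs2
  · -- `s` in the tip zone (strictly), `t` in the upper zone
    have h1 := b.deepTrack_one_lt_of_mem hκ h7 h7' ⟨hs1, hs2⟩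
    have h2 := b.le_deepTrack_one_of_ge hκ h7 h7' ⟨ht2.le, ht.2⟩
    linarith
  · -- both in the upper zone
    rw [b.deepTrack_of_ge hκ h7 h7' hs2, b.deepTrack_of_ge hκ h7 h7' ht2.le] at hst
    have ha := injOn_upperTurn (show b.alphaHi κ s ∈ Iic (5 : ℝ) from (b.alphaHi_mem_of_zone hκ h7' ⟨hs2, hs.2⟩).2)
      (show b.alphaHi κ t ∈ Iic (5 : ℝ) from (b.alphaHi_mem_of_zone hκ h7' ⟨ht2.le, ht.2⟩).2) hst
    have := (b.strictAntiOn_alphaHi (κ := κ) hκ) (b.mem_coreHi_of_zone hκ h7' ⟨hs2, hs.2⟩) (b.mem_coreHi_of_zone hκ h7' ⟨ht2.le, ht.2⟩) hlt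
    exact absurd ha this.ne'

/-- **The planar track is regular on `[parLo (-7), parHi (-7)]`.** [folklore] -/
theorem deriv_deepTrack_ne_zero {t : ℝ} (ht : t ∈ Icc (b.parLo hκ h7 neg_seven_mem) (b.parHi hκ h7' neg_seven_mem)) :
    deriv (b.deepTrack hκ h7 h7') t ≠ 0 := by
  have h45 : b.parLo hκ h7 nine_halves_mem < b.parLo hκ h7 five_mem := b.parLo_lt_parLo hκ h7 nine_halves_mem five_mem (by norm_num)
  have h45' : b.parHi hκ h7' five_mem < b.parHi hκ h7' nine_halves_mem := b.parHi_lt_parHi hκ h7' nine_halves_mem five_mem (by norm_num)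
  have hl5h5 := b.parLo_lt_parHi hκ h7 h7' five_mem five_mem
  rcases lt_or_ge t (b.parLo hκ h7 five_mem) with h1 | h1
  · -- lower zone: chain rule with `αLo' > 0`
    have hev : b.deepTrack hκ h7 h7' =ᶠ[𝓝 t] fun t ↦ lowerTurn (b.alphaLo κ t) := by
      filter_upwards [Iio_mem_nhds h1] with s hs using b.deepTrack_of_le hκ h7 h7' hs.le
    rw [hev.deriv_eq]
    have hc := b.mem_coreLo_of_zone hκ h7 ⟨ht.1, h1.le⟩
    have hd : HasDerivAt (fun t ↦ lowerTurn (b.alphaLo κ t)) ((deriv b.chiLo t / κ) • deriv lowerTurn (b.alphaLo κ t)) t :=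
      ((contDiff_lowerTurn.differentiable (by simp)) _).hasDerivAt.scomp t (b.hasDerivAt_alphaLo κ t)
    rw [hd.deriv]
    exact smul_ne_zero (div_pos (b.deriv_chiLo_pos hc) hκ).ne' (deriv_lowerTurn_ne_zero _)
  rcases le_or_gt t (b.parHi hκ h7' five_mem) with h2 | h2
  · -- tip zone
    have hev : b.deepTrack hκ h7 h7' =ᶠ[𝓝 t] fun t ↦ (pt2 4 (b.tipClock hκ h7 h7' t) : 𝔼 2) := by
      filter_upwards [Ioo_mem_nhds (show b.parLo hκ h7 nine_halves_mem < t by linarith) (show t < b.parHi hκ h7' nine_halves_mem by linarith)]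
        with s hs
      rcases lt_or_ge s (b.parHi hκ h7' five_mem) with h3 | h3
      · exact b.deepTrack_eq_tip_of_mem hκ h7 h7' ⟨hs.1.le, h3⟩
      · exact b.deepTrack_eq_tip_of_mem' hκ h7 h7' ⟨by linarith, hs.2.le⟩
    rw [hev.deriv_eq]
    have hd : HasDerivAt (fun t ↦ (pt2 4 (b.tipClock hκ h7 h7' t) : 𝔼 2)) (pt2 0 (deriv (b.tipClock hκ h7 h7') t)) t :=
      hasDerivAt_pt2 (hasDerivAt_const t 4) (((b.contDiff_tipClock hκ h7 h7').differentiable (by simp)) t).hasDerivAt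
    rw [hd.deriv]
    intro h0
    have : deriv (b.tipClock hκ h7 h7') t = 0 := by simpa using congrArg (fun p : 𝔼 2 ↦ p 1) h0
    exact (b.deriv_tipClock_pos hκ h7 h7' ⟨h1, h2⟩).ne' this
  · -- upper zone: chain rule with `αHi' < 0`
    have hev : b.deepTrack hκ h7 h7' =ᶠ[𝓝 t] fun t ↦ upperTurn (b.alphaHi κ t) := by
      filter_upwards [Ioi_mem_nhds h2] with s hs using b.deepTrack_of_ge hκ h7 h7' hs.le
    rw [hev.deriv_eq]
    have hc := b.mem_coreHi_of_zone hκ h7' ⟨h2.le, ht.2⟩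
    have hd : HasDerivAt (fun t ↦ upperTurn (b.alphaHi κ t)) ((deriv b.chiHi t / κ) • deriv upperTurn (b.alphaHi κ t)) t :=
      ((contDiff_upperTurn.differentiable (by simp)) _).hasDerivAt.scomp t (b.hasDerivAt_alphaHi κ t)
    rw [hd.deriv]
    exact smul_ne_zero (div_neg_of_neg_of_pos (b.deriv_chiHi_neg hc) hκ).ne (deriv_upperTurn_ne_zero _)

end BandData

end Literature.Topology.FourManifolds
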